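import Summits.CriticalPhenomena.PercolationContinuityZ3.Theorems.PercNearOneGluingNoHeavyQuantCornerPrefix
import HarnessLib

/-!
# QUANT lane R8, T-DEC: WITNESSES FOR THE WINDOW LAYERS — a generic "mid flow + proportional giant split" witness of `FlowAtT`,
# the all-giant layers (every mid column empty) decided by one inequality, and the slack `Φ` of an unflipped window layer

builds on p205010 (kernel theorem, internal audit signed; external expert review pending)

Support file (`--supports stmt-CriticalPhenomena-4575`), QUANT lane seat prim-quant-census-2 (gen 57), rung R8 of
`run/shared/lean/prim/quant/LADDER.md`; memo `run/shared/lean/prim/quant/prim-quant-census-2-g57/WINDOW-ATOMS-G57.md` §2.1–§2.3 / §4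
(files H1/H3).  Theorems only, standard axioms, no sorries.  Uses the typer's corner run and corner theorem (`…QuantCornerRun/Sound/Theorem`)
and this seat's prefix property (`…QuantCornerPrefix`).

* **`LawDec.flowAtT_of_midFlow`** — the generic witness: any nonnegative "mid flow" `m` supported on admissible (low, mid) pairs of layer
  `J`, shipping at most the masses of the lows and loading the mids at most to their masses, together with the pool inequality
  `x/(1−x)·Σ_lows (ν l − Σ_h m l h) ≤ Σ_{J < h ≤ M} ν h` (giants nonnegative), gives `FlowAtT x T J M ν` — the leftovers ride the giants
  proportionally to the giant masses (the proof of `flowAtT_of_cornerSucceeds` with the corner flow replaced by `m`).  This is the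
  vehicle of every perturbed witness in the proof of `WindowExtremeSmall`.
* `LawDec.cornerMidFlow_col_eq_zero` — a column that is a low, or has no mass, receives nothing in the corner run.
* **`LawDec.cornerSucceeds_iff_of_noMid`** — at a layer `J` where every mid column `h ≤ J`, `2h ≥ T` has `μ h = 0` (an ALL-GIANT layer,
  e.g. every window layer lying below a low atom of the support), the corner certificate is the single inequality
  `x/(1−x)·Σ_{l ≤ J, 2l < T} μ l ≤ Σ_{J < h ≤ M} μ h`; `decAtT_iff_of_noMid`.
* **`LawDec.windowPhi_nonneg`** — for an UNFLIPPED window layer `J ≤ j` (no low mass in `(J, j]`) of a probability law that is DEC(J):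
  `x/(1−x)·Σ_{l ≤ j, 2l<T} (cornerLeftover_j l + Σ_{J < h ≤ j} cornerMidFlow_j l h) ≤ Σ_{J < h ≤ M} μ h` — the truncated TOP corner run is a
  feasible witness at layer `J` (corner theorem at `J` + `cornerLeftover_prefix`).

[this work]; nothing here is cited as a published result.  The gluing rows served [cite: KozmaNitzan2024, Conjecture 3 (p. 15)]; product
measure [cite: Grimmett1999, §1.3 p. 10].
-/

noncomputable section

namespace Summit.CriticalPhenomena.PercolationContinuityZ3.Theorems

namespace Quant

open Finset

namespace LawDec

/-! ### The generic witness: a mid flow plus the proportional giant split -/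

/-- **GENERIC WITNESS OF THE FLOW FORM**: a nonnegative mid flow `m` on admissible (low, mid) pairs of layer `J` that ships at most
the low masses and loads the mids at most to their masses, plus the pool inequality for the leftovers against the (nonnegative) giant
masses, gives `FlowAtT x T J M ν` (`0 < x < 1`).  The witness splits every leftover over the giants proportionally to their masses.
[this work] -/
theorem flowAtT_of_midFlow (x T : ℝ) (J M : ℕ) (ν : ℕ → ℝ) (m : ℕ → ℕ → ℝ) (hx0 : 0 < x) (hx1 : x < 1)
    (hm0 : ∀ a b, 0 ≤ m a b)
    (hmsup : ∀ a b, m a b ≠ 0 → a ≤ J ∧ 2 * (a : ℝ) < T ∧ b ≤ M ∧ b ≤ J ∧ T < (a : ℝ) + b)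
    (hrow : ∀ a, a ≤ J → 2 * (a : ℝ) < T → ∑ b ∈ Finset.range (M + 1), m a b ≤ ν a)
    (hcol : ∀ b, b ≤ M → b ≤ J → T ≤ 2 * (b : ℝ) → ∑ a ∈ Finset.range (J + 1), usage x T J a b * m a b ≤ ν b)
    (hgiant0 : ∀ b, J + 1 ≤ b → b ≤ M → 0 ≤ ν b)
    (hpool : x / (1 - x) * ∑ a ∈ (Finset.range (J + 1)).filter (fun a : ℕ => 2 * (a : ℝ) < T),
        (ν a - ∑ b ∈ Finset.range (M + 1), m a b) ≤ ∑ b ∈ Finset.Ico (J + 1) (M + 1), ν b) :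
    FlowAtT x T J M ν := by
  generalize hS : ∑ a ∈ (Finset.range (J + 1)).filter (fun a : ℕ => 2 * (a : ℝ) < T),
      (ν a - ∑ b ∈ Finset.range (M + 1), m a b) = S at hpool
  generalize hG : ∑ b ∈ Finset.Ico (J + 1) (M + 1), ν b = G at hpool
  have h1x : 0 < 1 - x := by linarith
  have hxr : 0 < x / (1 - x) := div_pos hx0 h1x
  -- the leftover of a low
  have hleft0 : ∀ a, a ≤ J → 2 * (a : ℝ) < T → 0 ≤ ν a - ∑ b ∈ Finset.range (M + 1), m a b := by
    intro a ha hlow; linarith [hrow a ha hlow]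
  have hS0 : 0 ≤ S := by
    rw [← hS]
    exact Finset.sum_nonneg fun a ha => by
      obtain ⟨h1, h2⟩ := Finset.mem_filter.1 ha
      exact hleft0 a (Nat.lt_succ_iff.1 (Finset.mem_range.1 h1)) h2
  have hG0 : 0 ≤ G := by
    rw [← hG]
    exact Finset.sum_nonneg fun b hb => by
      obtain ⟨h1, h2⟩ := Finset.mem_Ico.1 hb
      exact hgiant0 b h1 (Nat.lt_succ_iff.1 h2)
  have hc0 : 0 ≤ (if G = 0 then (0:ℝ) else 1 / G) := by
    split_ifs
    · exact le_rfl
    · exact div_nonneg zero_le_one hG0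
  have hL0 : ∀ a, 0 ≤ (if a ≤ J ∧ 2 * (a : ℝ) < T then ν a - ∑ b ∈ Finset.range (M + 1), m a b else 0) := by
    intro a; split_ifs with h
    · exact hleft0 a h.1 h.2
    · exact le_rfl
  have hW0 : ∀ b, 0 ≤ (if J + 1 ≤ b ∧ b ≤ M then ν b else 0) := by
    intro b; split_ifs with h
    · exact hgiant0 b h.1 h.2
    · exact le_rfl
  refine ⟨fun a b => m a b
    + (if G = 0 then (0:ℝ) else 1 / G) * (if a ≤ J ∧ 2 * (a : ℝ) < T then ν a - ∑ b ∈ Finset.range (M + 1), m a b else 0)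
        * (if J + 1 ≤ b ∧ b ≤ M then ν b else 0), ?_, ?_, ?_, ?_⟩
  · -- nonnegativity
    intro a b
    have := hm0 a b
    have := mul_nonneg (mul_nonneg hc0 (hL0 a)) (hW0 b)
    dsimp only
    linarith
  · -- support
    intro a b hpos
    dsimp only at hpos
    by_cases hF : m a b = 0
    · rw [hF, zero_add] at hpos
      have hlow : a ≤ J ∧ 2 * (a : ℝ) < T := by
        by_contra hn; rw [if_neg hn, mul_zero, zero_mul] at hpos; exact lt_irrefl _ hpos
      have hgiant : J + 1 ≤ b ∧ b ≤ M := by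
        by_contra hn; rw [if_neg hn, mul_zero] at hpos; exact lt_irrefl _ hpos
      exact ⟨hlow.1, hlow.2, hgiant.2, Or.inl hgiant.1⟩
    · obtain ⟨h1, h2, h3, -, h5⟩ := hmsup a b hF
      exact ⟨h1, h2, h3, Or.inr h5⟩
  · -- rows: mid flow + leftover
    intro a haJ halow
    dsimp only
    rw [Finset.sum_add_distrib, ← Finset.mul_sum, if_pos (show a ≤ J ∧ 2 * (a : ℝ) < T from ⟨haJ, halow⟩),
      sum_range_ite_giant J M ν, hG]
    by_cases hG0' : G = 0
    · rw [if_pos hG0']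
      have hS0' : S = 0 := by
        rw [hG0'] at hpool
        nlinarith
      have hmem : a ∈ (Finset.range (J + 1)).filter (fun l : ℕ => 2 * (l : ℝ) < T) :=
        Finset.mem_filter.2 ⟨Finset.mem_range.2 (by omega), halow⟩
      have hz := (Finset.sum_eq_zero_iff_of_nonneg (fun l hl => by
        obtain ⟨q1, q2⟩ := Finset.mem_filter.1 hl
        exact hleft0 l (Nat.lt_succ_iff.1 (Finset.mem_range.1 q1)) q2)).1 (hS.trans hS0') a hmem
      simp only [zero_mul, add_zero]
      linarith
    · rw [if_neg hG0']
      field_simp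
      ring
  · -- columns
    intro b hbM hself
    dsimp only
    have e : ∀ a, usage x T J a b * (m a b
        + (if G = 0 then (0:ℝ) else 1 / G) * (if a ≤ J ∧ 2 * (a : ℝ) < T then ν a - ∑ b ∈ Finset.range (M + 1), m a b else 0)
          * (if J + 1 ≤ b ∧ b ≤ M then ν b else 0))
        = usage x T J a b * m a b
          + ((if G = 0 then (0:ℝ) else 1 / G) * (if J + 1 ≤ b ∧ b ≤ M then ν b else 0))
            * (usage x T J a b * (if a ≤ J ∧ 2 * (a : ℝ) < T then ν a - ∑ b ∈ Finset.range (M + 1), m a b else 0)) :=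
      fun a => by ring
    simp only [e, Finset.sum_add_distrib]
    rw [← Finset.mul_sum]
    by_cases hgb : J + 1 ≤ b
    · -- giant: no mid flow, usage x/(1−x)
      have hFz : ∀ a, usage x T J a b * m a b = 0 := by
        intro a
        by_cases hF : m a b = 0
        · rw [hF, mul_zero]
        · have := (hmsup a b hF).2.2.2.1; omega
      have hug : ∀ a ∈ Finset.range (J + 1),
          usage x T J a b * (if a ≤ J ∧ 2 * (a : ℝ) < T then ν a - ∑ b ∈ Finset.range (M + 1), m a b else 0)
            = x / (1 - x) * (if a ≤ J ∧ 2 * (a : ℝ) < T then ν a - ∑ b ∈ Finset.range (M + 1), m a b else 0) := by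
        intro a _; rw [usage_giant_eq x T J a b hgb]
      rw [Finset.sum_congr rfl (fun a _ => hFz a), Finset.sum_const_zero, zero_add, Finset.sum_congr rfl hug,
        ← Finset.mul_sum, sum_range_ite_low T J, hS, if_pos (show J + 1 ≤ b ∧ b ≤ M from ⟨hgb, hbM⟩)]
      by_cases hG0' : G = 0
      · rw [if_pos hG0']; simp only [zero_mul]; exact hgiant0 b hgb hbM
      · rw [if_neg hG0']
        have hGp : 0 < G := lt_of_le_of_ne hG0 (Ne.symm hG0')
        rw [show 1 / G * ν b * (x / (1 - x) * S) = ν b * ((x / (1 - x) * S) / G) by ring]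
        have hfrac : (x / (1 - x) * S) / G ≤ 1 := by rw [div_le_one hGp]; exact hpool
        nlinarith [hgiant0 b hgb hbM]
    · -- mid: the mid flow only
      have hng : ¬ (J + 1 ≤ b ∧ b ≤ M) := fun hn => hgb hn.1
      rw [if_neg hng]
      simp only [mul_zero, zero_mul, add_zero]
      have hbJ : b ≤ J := by omega
      have hT : T ≤ 2 * (b : ℝ) := by
        rcases hself with h | h
        · exact absurd h hgb
        · exact h
      exact hcol b hbM hbJ hT

/-! ### All-giant layers -/

/-- **a column that is a low, or carries no mass, receives nothing in the corner run** (`0 < x < 1`, `μ ≥ 0`). [this work] -/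
theorem cornerMidFlow_col_eq_zero (x T : ℝ) (J M : ℕ) (μ : ℕ → ℝ) (hx0 : 0 < x) (hx1 : x < 1) (hμ : ∀ k, 0 ≤ μ k)
    (b : ℕ) (hb : 2 * (b : ℝ) < T ∨ μ b = 0) (a : ℕ) : cornerMidFlow x T J M μ a b = 0 := by
  obtain ⟨h0, hsup, -, hcol⟩ := cornerFlow_inv x T J M μ hx0 hx1 hμ ((J + 1) * (J + 1)) le_rfl
  by_contra hne
  obtain ⟨haJ, -, hlow, hbM, hcomp, -⟩ := hsup a b hne
  rcases hb with hb | hb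
  · -- a compatible column is above `T/2`
    have : (a : ℝ) < b := by linarith
    linarith
  · -- a massless column cannot be loaded
    have hab : a < b := by
      by_contra hge; push Not at hge
      have : (b : ℝ) ≤ a := by exact_mod_cast hge
      linarith
    have hu : 0 < usage x T J a b := usage_pos_of_compat x T J a b hx0 hx1 hlow hab (Or.inr hcomp)
    have hpos : 0 < cornerMidFlow x T J M μ a b := lt_of_le_of_ne (h0 a b) (Ne.symm hne)
    have hmem : a ∈ Finset.range (J + 1) := Finset.mem_range.2 (by omega)
    have hle := hcol b
    rw [hb] at hle
    have hge : usage x T J a b * cornerMidFlow x T J M μ a b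
        ≤ ∑ l ∈ Finset.range (J + 1), usage x T J l b * cornerFlow x T J M μ ((J + 1) * (J + 1)) l b :=
      Finset.single_le_sum (f := fun l => usage x T J l b * cornerFlow x T J M μ ((J + 1) * (J + 1)) l b)
        (fun l _ => by
          by_cases hz : cornerFlow x T J M μ ((J + 1) * (J + 1)) l b = 0
          · rw [hz, mul_zero]
          · obtain ⟨-, -, q3, -, q5, -⟩ := hsup l b hz
            have hlb : l < b := by
              by_contra hge; push Not at hge
              have : (b : ℝ) ≤ l := by exact_mod_cast hge
              linarith
            exact mul_nonneg (usage_pos_of_compat x T J l b hx0 hx1 q3 hlb (Or.inr q5)).le (h0 l b)) hmem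
    have := mul_pos hu hpos
    unfold cornerMidFlow at this hge
    linarith

/-- **AT AN ALL-GIANT LAYER THE CORNER CERTIFICATE IS ONE INEQUALITY**: if every mid column `h ≤ J` with `T ≤ 2h` is massless, then the
corner run ships nothing to the mids, every low keeps its whole mass as leftover, and `CornerSucceeds` reads
`x/(1−x)·Σ_{l ≤ J, 2l < T} μ l ≤ Σ_{J < h ≤ M} μ h`. [this work] -/
theorem cornerSucceeds_iff_of_noMid (x T : ℝ) (J M : ℕ) (μ : ℕ → ℝ) (hx0 : 0 < x) (hx1 : x < 1) (hμ : ∀ k, 0 ≤ μ k)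
    (hno : ∀ h, h ≤ J → T ≤ 2 * (h : ℝ) → μ h = 0) :
    CornerSucceeds x T J M μ ↔
      x / (1 - x) * ∑ l ∈ (Finset.range (J + 1)).filter (fun l : ℕ => 2 * (l : ℝ) < T), μ l
        ≤ ∑ h ∈ Finset.Ico (J + 1) (M + 1), μ h := by
  have hleft : ∀ l, cornerLeftover x T J M μ l = μ l := by
    intro l
    unfold cornerLeftover
    have hz : ∀ h ∈ Finset.range (M + 1), cornerMidFlow x T J M μ l h = 0 := by
      intro h _
      by_cases hlow : 2 * (h : ℝ) < T
      · exact cornerMidFlow_col_eq_zero x T J M μ hx0 hx1 hμ h (Or.inl hlow) l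
      · by_cases hhJ : h ≤ J
        · exact cornerMidFlow_col_eq_zero x T J M μ hx0 hx1 hμ h (Or.inr (hno h hhJ (not_lt.1 hlow))) l
        · obtain ⟨-, hsup, -, -⟩ := cornerFlow_inv x T J M μ hx0 hx1 hμ ((J + 1) * (J + 1)) le_rfl
          by_contra hne
          have := (hsup l h hne).2.1
          omega
    rw [Finset.sum_eq_zero hz, sub_zero]
  unfold CornerSucceeds
  rw [Finset.sum_congr rfl (fun l _ => hleft l)]

/-- **DEC AT AN ALL-GIANT LAYER** (probability law on `{0..M}`, `0 < x < 1`): one inequality. [this work] -/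
theorem decAtT_iff_of_noMid (x T : ℝ) (J M : ℕ) (μ : ℕ → ℝ) (hx0 : 0 < x) (hx1 : x < 1) (hμ : ∀ k, 0 ≤ μ k)
    (hμM : ∀ h, M < h → μ h = 0) (hμ1 : ∑ h ∈ Finset.range (M + 1), μ h = 1)
    (hno : ∀ h, h ≤ J → T ≤ 2 * (h : ℝ) → μ h = 0) :
    DECAtT x T J M μ ↔
      x / (1 - x) * ∑ l ∈ (Finset.range (J + 1)).filter (fun l : ℕ => 2 * (l : ℝ) < T), μ l
        ≤ ∑ h ∈ Finset.Ico (J + 1) (M + 1), μ h :=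
  (decAtT_iff_cornerSucceeds x T J M μ hx0 hx1 hμ hμM hμ1).trans (cornerSucceeds_iff_of_noMid x T J M μ hx0 hx1 hμ hno)

/-! ### The slack of an unflipped window layer -/

/-- the leftover of a massless low vanishes, and so does every entry of its row. -/
theorem cornerLeftover_eq_zero_of_mass (x T : ℝ) (J M : ℕ) (μ : ℕ → ℝ) (hx0 : 0 < x) (hx1 : x < 1) (hμ : ∀ k, 0 ≤ μ k)
    (l : ℕ) (hl : μ l = 0) :
    cornerLeftover x T J M μ l = 0 ∧ ∀ h, cornerMidFlow x T J M μ l h = 0 := by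
  obtain ⟨h0, -, hrow, -⟩ := cornerFlow_inv x T J M μ hx0 hx1 hμ ((J + 1) * (J + 1)) le_rfl
  have hr := hrow l
  rw [hl] at hr
  have hz : ∀ h ∈ Finset.range (M + 1), cornerFlow x T J M μ ((J + 1) * (J + 1)) l h = 0 := by
    intro h hh
    have hge := Finset.single_le_sum (f := fun h => cornerFlow x T J M μ ((J + 1) * (J + 1)) l h) (fun h _ => h0 l h) hh
    exact le_antisymm (by simpa using hge.trans hr) (h0 l h)
  refine ⟨?_, fun h => ?_⟩
  · unfold cornerLeftover cornerMidFlow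
    rw [hl, Finset.sum_eq_zero hz, sub_zero]
  · by_cases hh : h ∈ Finset.range (M + 1)
    · exact hz h hh
    · obtain ⟨-, hsup, -, -⟩ := cornerFlow_inv x T J M μ hx0 hx1 hμ ((J + 1) * (J + 1)) le_rfl
      by_contra hne
      have := (hsup l h hne).2.2.2.1
      exact hh (Finset.mem_range.2 (by omega))

/-- **THE SLACK OF AN UNFLIPPED WINDOW LAYER IS NONNEGATIVE** (`0 < x < 1`, probability law `μ` on `{0..M}`, `J ≤ j`, no low mass in
`(J, j]`): if `μ` is DEC(J) at target `T`, the top corner run (layer `j`) truncated at the column `J` is a feasible witness at layer `J`: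
`x/(1−x)·Σ_{l ≤ j, 2l < T} (cornerLeftover_j l + Σ_{J < h ≤ j} cornerMidFlow_j l h) ≤ Σ_{J < h ≤ M} μ h`. [this work] -/
theorem windowPhi_nonneg (x T : ℝ) (J j M : ℕ) (μ : ℕ → ℝ) (hx0 : 0 < x) (hx1 : x < 1) (hμ : ∀ k, 0 ≤ μ k)
    (hμM : ∀ h, M < h → μ h = 0) (hμ1 : ∑ h ∈ Finset.range (M + 1), μ h = 1) (hJ : J ≤ j)
    (hgap : ∀ l, J < l → l ≤ j → 2 * (l : ℝ) < T → μ l = 0) (hdec : DECAtT x T J M μ) :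
    x / (1 - x) * ∑ l ∈ (Finset.range (j + 1)).filter (fun l : ℕ => 2 * (l : ℝ) < T),
        (cornerLeftover x T j M μ l
          + ∑ h ∈ Finset.range (M + 1), (if J < h ∧ h ≤ j then cornerMidFlow x T j M μ l h else 0))
      ≤ ∑ h ∈ Finset.Ico (J + 1) (M + 1), μ h := by
  have hC := (decAtT_iff_cornerSucceeds x T J M μ hx0 hx1 hμ hμM hμ1).1 hdec
  unfold CornerSucceeds at hC
  -- the leftovers of the `J`-run are the truncated leftovers of the `j`-run
  have e1 : ∀ l, cornerLeftover x T J M μ l = cornerLeftover x T j M μ l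
      + ∑ h ∈ Finset.range (M + 1), (if J < h ∧ h ≤ j then cornerMidFlow x T j M μ l h else 0) :=
    fun l => cornerLeftover_prefix x T J j M μ hx0 hx1 hμ hJ hgap l
  -- the lows in `(J, j]` contribute nothing
  have e2 : ∑ l ∈ (Finset.range (j + 1)).filter (fun l : ℕ => 2 * (l : ℝ) < T),
        (cornerLeftover x T j M μ l + ∑ h ∈ Finset.range (M + 1), (if J < h ∧ h ≤ j then cornerMidFlow x T j M μ l h else 0))
      = ∑ l ∈ (Finset.range (J + 1)).filter (fun l : ℕ => 2 * (l : ℝ) < T), cornerLeftover x T J M μ l := by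
    symm
    rw [Finset.sum_congr rfl (fun l _ => e1 l)]
    apply Finset.sum_subset
    · intro l hl
      obtain ⟨h1, h2⟩ := Finset.mem_filter.1 hl
      exact Finset.mem_filter.2 ⟨Finset.mem_range.2 (by have := Finset.mem_range.1 h1; omega), h2⟩
    · intro l hl hnot
      obtain ⟨h1, h2⟩ := Finset.mem_filter.1 hl
      have hlj : l ≤ j := Nat.lt_succ_iff.1 (Finset.mem_range.1 h1)
      have hJl : J < l := by
        by_contra hle; push Not at hle
        exact hnot (Finset.mem_filter.2 ⟨Finset.mem_range.2 (by omega), h2⟩)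
      obtain ⟨q1, q2⟩ := cornerLeftover_eq_zero_of_mass x T j M μ hx0 hx1 hμ l (hgap l hJl hlj h2)
      rw [q1, zero_add]
      exact Finset.sum_eq_zero fun h _ => by rw [q2 h]; split_ifs <;> rfl
  rw [e2]
  exact hC

end LawDec

end Quant

end Summit.CriticalPhenomena.PercolationContinuityZ3.Theorems
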